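import Summits.ResolutionOfSingularities.ResolutionOfSingularities.Theorems.EquisingularLiftEquisingularLiftNatSpecimenS10AllFramesSteps
import Mathlib.LinearAlgebra.Matrix.Determinant.Basic
import HarnessLib

/-!
# [OURS · L1 W4.5(b) · EL♮(3) · D3-6 (b′)] `S10` IS NON-ND IN EVERY POLYNOMIAL FRAME — part 2/2 (`…NatSpecimenS10AllFrames`):
# STEP 1 `(1,1,1)`, the assembly over all substitutions with invertible Jacobian (T1), and all origin-fixing automorphisms (T2)

Cell `res-hironaka`, crux EL♮(3) `EquisingularLiftNatThree` (stmt-ResolutionOfSingularities-20148), chain W4.5b, line `sections`; WIDTH TABLE D3 row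
D3-6 (b′) (desk RULING 2026-08-28T17:46Z; signatures (T1)/(T2) pre-cleared by res-L1-w45b-crit-2 2026-08-28T17:48Z).  res-L1-w45b-iso-w1 g2.  OURS; NOT a
statement of any manuscript; nothing of [Hironaka2017] is asserted; AI-written kernel algebra, weaker than expert review.  Def-free, `sorry`-free, standard
axioms.  `--kind proof --supports stmt-ResolutionOfSingularities-20148 --as helper`.

WHAT (see part 1 `…NatSpecimenS10AllFramesSteps` for the mathematics of STEPS 2–3).
* `S10AllFrames.step1` — weight `(1,1,1)`: `in(S10 ∘ φ) = ℓ_x⁴` (`ℓ_x` = linear part of `φ₀`, the tangent cone `x⁴` transported); if `ℓ_x` has two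
  monomials, `S10 ∘ φ` is not locally ND.
* `S10AllFrames.step2` / `S10AllFrames.mainZero` — the column normal form `ℓ_x = α t₀`: `det = α·δ` (`Matrix.det_fin_three`); binomial `m_z` ⇒ `step2A`;
  monomial `m_z` ⇒ `step3`, after the transposition `t₁ ↔ t₂` (`ND.isLocallyNewtonNondegenerate_rename_iff`) if needed.
* ★ **(T1) `not_isLocallyNewtonNondegenerate_aeval_specimenS10`** — `k = k̄`, any characteristic: for all `φ : Fin 3 → k[t₀,t₁,t₂]` with
  `∀ j, φⱼ(0) = 0` and `det (∂φⱼ/∂tᵢ (0)) ≠ 0`, `¬ IsLocallyNewtonNondegenerate (aeval φ S10)`.  (Else `ℓ_x = α tᵢ` — a zero column kills the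
  determinant —; transpose `t₀ ↔ tᵢ`, `Matrix.det_permute`; `mainZero`.)  Both hypotheses are load-bearing: `φ = (t₀, 0, 0)` gives the locally ND
  `t₀⁴ + t₀⁵ + t₀¹⁰`; `φ = (1 + t₀, t₁, t₂)` (char ≠ 3) gives a unit (res-L1-w45b-crit-2's pre-clear).
* ★ **(T2) `not_isLocallyNewtonNondegenerate_specimenS10_allFrames`**, `not_localND_specimenS10_allFrames`, `not_localNDWon_specimenS10_allFrames` — for
  EVERY origin-fixing `k`-algebra automorphism `θ` of `k[t₀,t₁,t₂]` (`FixesOrigin θ`, the frame quantifier of `IsoHypND`/`IsoHypNDWon`):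
  `¬ IsLocallyNewtonNondegenerate (θ S10)`, hence `¬ LocalND`, `¬ LocalNDWon`.  At `θ = 1` this is ✓ `not_localND_specimenS10` (…NatSpecimenS10).
  The reduction (T2) ⇐ (T1): `θ = aeval (θ ∘ X)`, and the Jacobian at `0` of an origin-fixing automorphism is invertible
  (`S10AllFrames.det_jacobian_ne_zero_of_fixesOrigin`: `J(θ)·J(θ⁻¹) = 1` via `S10AllFrames.coeff_single_aeval`, «linear parts compose», itself from
  `S10AllFrames.two_le_wt_aeval`, «a substitution without constant terms preserves order ≥ 2»).

HONEST SCOPE.  Germ level: S10's local equation at its singular point is non-ND in every POLYNOMIAL frame of the chart (formal/analytic coordinate changes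
are not frames of `IsoHypND` and are not treated).  The `IsoHypND`-level negation for the projective surface `V₊(S10ʰ) ⊂ ℙ³` needs in addition
`IsZeroSetOf` + irreducibility of `S10ʰ` (every set-theoretic equation is `c·S10ʰᵐ`) — NOT claimed here.  res-L1-w45b-lead-1's claim «S10 outside
A⁗-prefix ⊕ ND-leaves after EVERY prefix» stays a memo-level claim (D3-6 (b)).  Dim-3 char-p resolution is a theorem in print (Cossart–Piltant 2008/2009);
this is OUR kernel-own bookkeeping for OUR engine's residue, counted 0 toward the summit; EL♮(3) is NOT proved here.
-/

set_option linter.dupNamespace false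

noncomputable section

open MvPolynomial

namespace Summit.ResolutionOfSingularities.ResolutionOfSingularities.Cruxes.EquisingularLiftNat.Sections

open ND

variable {k : Type} [Field k]

namespace S10AllFrames

/-! ## §4 STEP 1 — the linear part of `φ₀` has TWO monomials: the weight `(1,1,1)` exhibits `in = ℓ_x⁴` -/

/-- **STEP 1.**  If the linear part `ℓ_x` of `φ₀` has two distinct monomials `t_i`, `t_{i'}`, then `S10 ∘ φ` is NOT locally Newton-nondegenerate:
for `Ω = (1,1,1)` the initial form is `ℓ_x⁴ = ℓ_x² · ℓ_x²` (the tangent cone `x⁴` transported), and `ℓ_x` is a binomial. [OURS · L1 W4.5b · D3-6 (b′)] -/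
theorem step1 [IsAlgClosed k] (φ : Fin 3 → MvPolynomial (Fin 3) k) (h0 : ∀ j, constantCoeff (φ j) = 0) {i i' : Fin 3} (hii' : i ≠ i')
    (hi : coeff (Finsupp.single i 1) (φ 0) ≠ 0) (hi' : coeff (Finsupp.single i' 1) (φ 0) ≠ 0) :
    ¬ IsLocallyNewtonNondegenerate (aeval φ (specimenS10 k)) := by
  classical
  set X₁ := φ 0 with hX₁
  set Y₁ := φ 1 with hY₁
  set Z₁ := φ 2 with hZ₁
  set c₀ : k := coeff (eG3 1 0 0) X₁ with hc₀
  set c₁ : k := coeff (eG3 0 1 0) X₁ with hc₁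
  set c₂ : k := coeff (eG3 0 0 1) X₁ with hc₂
  set Ω : Fin 3 → ℤ := fun _ => 1 with hΩ
  have hΩpos : ∀ i, 0 < Ω i := fun _ => by simp [hΩ]
  have hΩone : ∀ i, 1 ≤ Ω i := fun _ => by simp [hΩ]
  set ℓ : MvPolynomial (Fin 3) k := monomial (eG3 1 0 0) c₀ + monomial (eG3 0 1 0) c₁ + monomial (eG3 0 0 1) c₂ with hℓ
  set A := X₁ - ℓ with hA
  have hX0 : coeff (eG3 0 0 0) X₁ = 0 := by rw [coeff_eG3_zero_eq_constantCoeff]; exact h0 0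
  have hAwt : ∀ m ∈ A.support, (2 : ℤ) ≤ wt Ω m := by
    rw [wtGe_iff_coeff_eq_zero]
    intro m hm
    obtain ⟨p, q, r, rfl⟩ : ∃ p q r, m = eG3 p q r := ⟨m 0, m 1, m 2, (eG3_eta m).symm⟩
    rw [hΩ, wt_w111_eG3] at hm
    have hcases : (p = 0 ∧ q = 0 ∧ r = 0) ∨ (p = 1 ∧ q = 0 ∧ r = 0) ∨ (p = 0 ∧ q = 1 ∧ r = 0) ∨ (p = 0 ∧ q = 0 ∧ r = 1) := by
      omega
    rcases hcases with ⟨rfl, rfl, rfl⟩ | ⟨rfl, rfl, rfl⟩ | ⟨rfl, rfl, rfl⟩ | ⟨rfl, rfl, rfl⟩ <;>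
      simp [hA, hℓ, coeff_monomial, eG3_eq_iff, hX0, hc₀, hc₁, hc₂]
  have hℓwt : ∀ m ∈ ℓ.support, wt Ω m = 1 := by
    refine wtEq_add (wtEq_add ?_ ?_) ?_ <;>
    · intro m hm; rw [wtEq_monomial Ω _ _ m hm, hΩ, wt_w111_eG3]; norm_num
  have hℓge : ∀ m ∈ ℓ.support, (1 : ℤ) ≤ wt Ω m := fun m hm => (hℓwt m hm).symm.le
  have hX₁wt : ∀ m ∈ X₁.support, (1 : ℤ) ≤ wt Ω m := one_le_wt_of_constantCoeff_eq_zero hΩone (h0 0)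
  have hY₁wt : ∀ m ∈ Y₁.support, (1 : ℤ) ≤ wt Ω m := one_le_wt_of_constantCoeff_eq_zero hΩone (h0 1)
  have hZ₁wt : ∀ m ∈ Z₁.support, (1 : ℤ) ≤ wt Ω m := one_le_wt_of_constantCoeff_eq_zero hΩone (h0 2)
  -- the coefficient table of `ℓ` and its two monomials
  have hcoeffℓ : ∀ j : Fin 3, coeff (Finsupp.single j 1) ℓ = coeff (Finsupp.single j 1) X₁ := by
    intro j
    fin_cases j
    · simp [hℓ, single_zero_eq_eG3, coeff_monomial, eG3_eq_iff, hc₀]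
    · simp [hℓ, single_one_eq_eG3, coeff_monomial, eG3_eq_iff, hc₁]
    · simp [hℓ, single_two_eq_eG3, coeff_monomial, eG3_eq_iff, hc₂]
  have ha : Finsupp.single i 1 ∈ ℓ.support := by rw [mem_support_iff, hcoeffℓ]; exact hi
  have hb : Finsupp.single i' 1 ∈ ℓ.support := by rw [mem_support_iff, hcoeffℓ]; exact hi'
  have hab : (Finsupp.single i 1 : Fin 3 →₀ ℕ) ≠ Finsupp.single i' 1 := fun h => hii' (Finsupp.single_left_injective one_ne_zero h)
  have hℓ0 : ℓ ≠ 0 := fun h => by rw [h] at ha; simp at ha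
  have hℓ40 : ℓ ^ 4 ≠ 0 := pow_ne_zero 4 hℓ0
  have hℓ4wt : ∀ m ∈ (ℓ ^ 4).support, wt Ω m = 4 := by
    intro m hm; rw [wtEq_pow hℓwt 4 m hm]; norm_num
  -- the remainder
  have hX₁eq : X₁ = ℓ + A := by rw [hA]; ring
  set qq := X₁ ^ 2 + Y₁ ^ 2 * Z₁ with hqq
  set D := A * (X₁ + ℓ) + Y₁ ^ 2 * Z₁ with hD
  have hDwt : ∀ m ∈ D.support, (3 : ℤ) ≤ wt Ω m := by
    refine wtGe_add ?_ ?_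
    · have := wtGe_mul hAwt (wtGe_add hX₁wt hℓge); exact wtGe_mono (by norm_num) this
    · have := wtGe_mul (wtGe_pow hY₁wt 2) hZ₁wt; exact wtGe_mono (by norm_num) this
  have hqqwt : ∀ m ∈ (qq + ℓ ^ 2).support, (2 : ℤ) ≤ wt Ω m := by
    refine wtGe_add (wtGe_add ?_ ?_) ?_
    · have := wtGe_pow hX₁wt 2; exact wtGe_mono (by norm_num) this
    · have := wtGe_mul (wtGe_pow hY₁wt 2) hZ₁wt; exact wtGe_mono (by norm_num) this
    · have := wtGe_pow hℓge 2; exact wtGe_mono (by norm_num) this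
  set r := D * (qq + ℓ ^ 2) + X₁ ^ 5 + Z₁ ^ 6 + X₁ * Y₁ ^ 8 + X₁ ^ 10 + Y₁ ^ 10 + Z₁ ^ 10 with hr
  have hrwt : ∀ m ∈ r.support, (4 : ℤ) + 1 ≤ wt Ω m := by
    refine wtGe_add (wtGe_add (wtGe_add (wtGe_add (wtGe_add (wtGe_add ?_ ?_) ?_) ?_) ?_) ?_) ?_
    · have := wtGe_mul hDwt hqqwt; exact wtGe_mono (by norm_num) this
    · have := wtGe_pow hX₁wt 5; exact wtGe_mono (by norm_num) this
    · have := wtGe_pow hZ₁wt 6; exact wtGe_mono (by norm_num) this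
    · have := wtGe_mul hX₁wt (wtGe_pow hY₁wt 8); exact wtGe_mono (by norm_num) this
    · have := wtGe_pow hX₁wt 10; exact wtGe_mono (by norm_num) this
    · have := wtGe_pow hY₁wt 10; exact wtGe_mono (by norm_num) this
    · have := wtGe_pow hZ₁wt 10; exact wtGe_mono (by norm_num) this
  have hg : aeval φ (specimenS10 k) = ℓ ^ 4 + r := by
    rw [aeval_specimenS10, ← hX₁, ← hY₁, ← hZ₁, hr, hD, hqq, hA]
    ring
  have hin : initialForm Ω (aeval φ (specimenS10 k)) = ℓ ^ 2 * ℓ ^ 2 := by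
    rw [← pow_add]; exact initialForm_eq_of_add_wtGe Ω hg hℓ40 hℓ4wt hrwt
  exact not_isLocallyND_of_initialForm_eq_sq_mul hΩpos hin ha hb hab


/-! ## §5 Renaming plumbing (transpositions of the new variables) -/

/-- Linear coefficients of a renamed polynomial. [OURS · bookkeeping] -/
theorem coeff_single_rename_equiv (σ : Fin 3 ≃ Fin 3) (P : MvPolynomial (Fin 3) k) (i : Fin 3) (n : ℕ) :
    coeff (Finsupp.single i n) (rename σ P) = coeff (Finsupp.single (σ.symm i) n) P := by
  rw [coeff_rename_equiv, Finsupp.mapDomain_single]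

/-- Substituting renamed polynomials = renaming the substituted polynomial. [OURS · bookkeeping] -/
theorem aeval_rename_comp (σ : Fin 3 ≃ Fin 3) (φ : Fin 3 → MvPolynomial (Fin 3) k) (g : MvPolynomial (Fin 3) k) :
    aeval (fun j => rename σ (φ j)) g = rename σ (aeval φ g) := by
  rw [← comp_aeval, AlgHom.comp_apply]

/-- The transposition `(1 2)` of `Fin 3`: values of its inverse. [OURS · bookkeeping] -/
theorem swap12_symm_apply :
    (Equiv.swap (1 : Fin 3) 2).symm 0 = 0 ∧ (Equiv.swap (1 : Fin 3) 2).symm 1 = 2 ∧ (Equiv.swap (1 : Fin 3) 2).symm 2 = 1 := by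
  decide

/-! ## §6 STEP 2 assembled: `ℓ_x = α t₀` and `(m_y, m_z)` independent ⇒ dead (binomial `m_z`: `step2A`; monomial `m_z`: `step3`, after `(1 2)` if needed) -/

/-- **STEP 2.**  If the linear part of `φ₀` is `α t₀` (`α ≠ 0`) and the `2 × 2` minor `δ = p₁q₂ − q₁p₂` of the linear parts of `φ₁`, `φ₂` on `t₁, t₂` is
non-zero, then `S10 ∘ φ` is NOT locally Newton-nondegenerate. [OURS · L1 W4.5b · D3-6 (b′)] -/
theorem step2 [IsAlgClosed k] (φ : Fin 3 → MvPolynomial (Fin 3) k) (h0 : ∀ j, constantCoeff (φ j) = 0) {α : k} (hα : α ≠ 0)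
    (hx0 : coeff (Finsupp.single 0 1) (φ 0) = α) (hx1 : coeff (Finsupp.single 1 1) (φ 0) = 0)
    (hx2 : coeff (Finsupp.single 2 1) (φ 0) = 0)
    (hδ : coeff (Finsupp.single 1 1) (φ 1) * coeff (Finsupp.single 2 1) (φ 2) -
      coeff (Finsupp.single 1 1) (φ 2) * coeff (Finsupp.single 2 1) (φ 1) ≠ 0) :
    ¬ IsLocallyNewtonNondegenerate (aeval φ (specimenS10 k)) := by
  classical
  by_cases hq : coeff (Finsupp.single 1 1) (φ 2) ≠ 0 ∧ coeff (Finsupp.single 2 1) (φ 2) ≠ 0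
  · exact step2A φ h0 hx1 hx2 hq.1 hq.2 hδ
  rw [not_and_or, not_not, not_not] at hq
  rcases hq with hq1 | hq2
  · -- `m_z = q₂ t₂`: transpose `t₁ ↔ t₂`, then STEP 3
    have hp1 : coeff (Finsupp.single 1 1) (φ 1) ≠ 0 := by
      intro h; apply hδ; rw [h, hq1, zero_mul, zero_mul, sub_zero]
    have hq2 : coeff (Finsupp.single 2 1) (φ 2) ≠ 0 := by
      intro h; apply hδ; rw [h, hq1, mul_zero, zero_mul, sub_zero]
    obtain ⟨hs0, hs1, hs2⟩ := (swap12_symm_apply : (Equiv.swap (1 : Fin 3) 2).symm 0 = 0 ∧ _)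
    have h0' : ∀ j, constantCoeff ((fun j => rename (Equiv.swap (1 : Fin 3) 2) (φ j)) j) = 0 := fun j => by
      simp only [constantCoeff_rename, h0]
    have key := step3 (fun j => rename (Equiv.swap (1 : Fin 3) 2) (φ j)) h0' hα hq2 hp1
      (by simp only [coeff_single_rename_equiv, hs0, hx0])
      (by simp only [coeff_single_rename_equiv, hs1, hx2])
      (by simp only [coeff_single_rename_equiv, hs2, hx1])
      (by simp only [coeff_single_rename_equiv, hs2])
      (by simp only [coeff_single_rename_equiv, hs1])
      (by simp only [coeff_single_rename_equiv, hs2, hq1])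
    rw [aeval_rename_comp, isLocallyNewtonNondegenerate_rename_iff] at key
    exact key
  · -- `m_z = q₁ t₁`: STEP 3 directly
    have hp2 : coeff (Finsupp.single 2 1) (φ 1) ≠ 0 := by
      intro h; apply hδ; rw [h, hq2, mul_zero, mul_zero, sub_zero]
    have hq1 : coeff (Finsupp.single 1 1) (φ 2) ≠ 0 := by
      intro h; apply hδ; rw [h, hq2, mul_zero, zero_mul, sub_zero]
    exact step3 φ h0 hα hq1 hp2 hx0 hx1 hx2 rfl rfl hq2

/-- **Column normal form.**  If the linear part of `φ₀` is `α t₀` (`α ≠ 0`) and the Jacobian matrix at `0` is invertible, then `S10 ∘ φ` is NOT locally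
Newton-nondegenerate (`det = α · δ` by `Matrix.det_fin_three`, then `step2`). [OURS · L1 W4.5b · D3-6 (b′)] -/
theorem mainZero [IsAlgClosed k] (φ : Fin 3 → MvPolynomial (Fin 3) k) (h0 : ∀ j, constantCoeff (φ j) = 0)
    (hdet : (Matrix.of fun i j => coeff (Finsupp.single i 1) (φ j)).det ≠ 0)
    (hi : coeff (Finsupp.single 0 1) (φ 0) ≠ 0) (hx1 : coeff (Finsupp.single 1 1) (φ 0) = 0)
    (hx2 : coeff (Finsupp.single 2 1) (φ 0) = 0) : ¬ IsLocallyNewtonNondegenerate (aeval φ (specimenS10 k)) := by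
  refine step2 φ h0 hi rfl hx1 hx2 ?_
  rw [Matrix.det_fin_three] at hdet
  simp only [Matrix.of_apply, hx1, hx2, mul_zero, zero_mul, sub_zero, add_zero] at hdet
  intro h
  apply hdet
  have : coeff (Finsupp.single 0 1) (φ 0) * coeff (Finsupp.single 1 1) (φ 1) * coeff (Finsupp.single 2 1) (φ 2) -
      coeff (Finsupp.single 0 1) (φ 0) * coeff (Finsupp.single 1 1) (φ 2) * coeff (Finsupp.single 2 1) (φ 1) =
      coeff (Finsupp.single 0 1) (φ 0) * (coeff (Finsupp.single 1 1) (φ 1) * coeff (Finsupp.single 2 1) (φ 2) -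
      coeff (Finsupp.single 1 1) (φ 2) * coeff (Finsupp.single 2 1) (φ 1)) := by ring
  rw [this, h, mul_zero]

end S10AllFrames

open S10AllFrames

/-! ## §7 (T1) — every substitution with invertible Jacobian and no constant terms -/

/-- **(T1) `S10` IS NON-ND UNDER EVERY SUBSTITUTION WITH INVERTIBLE LINEAR PART.**  For `k` algebraically closed (any characteristic) and polynomials
`φ₀, φ₁, φ₂ ∈ k[t₀,t₁,t₂]` without constant term whose Jacobian matrix at the origin `(∂φⱼ/∂tᵢ(0))` is invertible, the substituted specimen
`S10(φ₀, φ₁, φ₂)` is NOT locally Newton-nondegenerate.  Proof: if the linear part `ℓ_x` of `φ₀` has two monomials, STEP 1; else `ℓ_x = α tᵢ` (a zero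
column would kill the determinant), transpose `t₀ ↔ tᵢ` (`ND.isLocallyNewtonNondegenerate_rename_iff`, `Matrix.det_permute`) and apply `mainZero`.
[OURS · L1 W4.5b · D3-6 (b′): res-L1-w45b-lead-1's RESIDUE-CUSTOMER-S10 §3 claim (H1), germ level, in the kernel] -/
theorem not_isLocallyNewtonNondegenerate_aeval_specimenS10 [IsAlgClosed k] (φ : Fin 3 → MvPolynomial (Fin 3) k)
    (h0 : ∀ j, constantCoeff (φ j) = 0) (hdet : (Matrix.of fun i j => coeff (Finsupp.single i 1) (φ j)).det ≠ 0) :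
    ¬ IsLocallyNewtonNondegenerate (aeval φ (specimenS10 k)) := by
  classical
  by_cases h2 : ∃ i i' : Fin 3, i ≠ i' ∧ coeff (Finsupp.single i 1) (φ 0) ≠ 0 ∧ coeff (Finsupp.single i' 1) (φ 0) ≠ 0
  · obtain ⟨i, i', hii', hi, hi'⟩ := h2
    exact step1 φ h0 hii' hi hi'
  push Not at h2
  -- the first column of the Jacobian is non-zero …
  obtain ⟨i, hi⟩ : ∃ i, coeff (Finsupp.single i 1) (φ 0) ≠ 0 := by
    by_contra hcon
    push Not at hcon
    exact hdet (Matrix.det_eq_zero_of_column_eq_zero 0 fun i => by rw [Matrix.of_apply]; exact hcon i)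
  -- … and supported on the single row `i`
  have hzero : ∀ i', i' ≠ i → coeff (Finsupp.single i' 1) (φ 0) = 0 := fun i' hne => h2 i i' hne.symm hi
  -- transpose `t₀ ↔ tᵢ`
  set σ : Fin 3 ≃ Fin 3 := Equiv.swap 0 i with hσ
  have hσsymm : σ.symm = σ := by rw [hσ, Equiv.symm_swap]
  set φ' : Fin 3 → MvPolynomial (Fin 3) k := fun j => rename σ (φ j) with hφ'
  have h0' : ∀ j, constantCoeff (φ' j) = 0 := fun j => by simp only [hφ', constantCoeff_rename, h0]
  have hcoeff' : ∀ i'' j, coeff (Finsupp.single i'' 1) (φ' j) = coeff (Finsupp.single (σ i'') 1) (φ j) := by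
    intro i'' j; simp only [hφ', coeff_single_rename_equiv, hσsymm]
  have hdet' : (Matrix.of fun i'' j => coeff (Finsupp.single i'' 1) (φ' j)).det ≠ 0 := by
    have hM : (Matrix.of fun i'' j => coeff (Finsupp.single i'' 1) (φ' j)) =
        (Matrix.of fun i'' j => coeff (Finsupp.single i'' 1) (φ j)).submatrix σ id := by
      ext i'' j; simp only [Matrix.of_apply, Matrix.submatrix_apply, id, hcoeff']
    rw [hM, Matrix.det_permute]
    refine mul_ne_zero ?_ hdet
    rcases Int.units_eq_one_or (Equiv.Perm.sign σ) with h | h <;> simp [h]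
  have hi' : coeff (Finsupp.single 0 1) (φ' 0) ≠ 0 := by
    rw [hcoeff', hσ, Equiv.swap_apply_left]; exact hi
  have hne : ∀ i'' : Fin 3, i'' ≠ 0 → σ i'' ≠ i := by
    intro i'' hne h
    apply hne
    have : σ.symm (σ i'') = σ.symm i := by rw [h]
    rw [Equiv.symm_apply_apply, hσsymm, hσ, Equiv.swap_apply_right] at this
    exact this
  have hx1' : coeff (Finsupp.single 1 1) (φ' 0) = 0 := by rw [hcoeff']; exact hzero _ (hne 1 (by decide))
  have hx2' : coeff (Finsupp.single 2 1) (φ' 0) = 0 := by rw [hcoeff']; exact hzero _ (hne 2 (by decide))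
  have key := mainZero φ' h0' hdet' hi' hx1' hx2'
  rw [hφ', aeval_rename_comp, isLocallyNewtonNondegenerate_rename_iff] at key
  exact key

/-! ## §8 (T2) — every origin-fixing polynomial automorphism (the `IsoHypND` quantifier) -/

namespace S10AllFrames

/-- An origin-fixing automorphism preserves constant coefficients. [OURS · bookkeeping] -/
theorem constantCoeff_apply_of_fixesOrigin (θ : MvPolynomial (Fin 3) k ≃ₐ[k] MvPolynomial (Fin 3) k) (hθ : FixesOrigin θ)
    (P : MvPolynomial (Fin 3) k) : constantCoeff (θ P) = constantCoeff P := by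
  have h1 : (aeval (fun _ : Fin 3 => (0 : k))).comp (θ : MvPolynomial (Fin 3) k →ₐ[k] MvPolynomial (Fin 3) k) =
      aeval (fun _ : Fin 3 => (0 : k)) := by
    refine MvPolynomial.algHom_ext fun j => ?_
    rw [AlgHom.comp_apply, aeval_X, AlgEquiv.coe_toAlgHom, aeval_zero']
    simpa using hθ j
  have h2 := DFunLike.congr_fun h1 P
  rw [AlgHom.comp_apply, AlgEquiv.coe_toAlgHom, aeval_zero', aeval_zero'] at h2
  simpa using h2

/-- The inverse of an origin-fixing automorphism fixes the origin. [OURS · bookkeeping] -/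
theorem fixesOrigin_symm (θ : MvPolynomial (Fin 3) k ≃ₐ[k] MvPolynomial (Fin 3) k) (hθ : FixesOrigin θ) : FixesOrigin θ.symm := by
  intro j
  have := constantCoeff_apply_of_fixesOrigin θ hθ (θ.symm (X j))
  rw [AlgEquiv.apply_symm_apply, constantCoeff_X] at this
  exact this.symm

/-- A substitution without constant terms maps «all monomials of degree `≥ 2`» into itself. [OURS · bookkeeping] -/
theorem two_le_wt_aeval (φ : Fin 3 → MvPolynomial (Fin 3) k) (h0 : ∀ j, constantCoeff (φ j) = 0) (P : MvPolynomial (Fin 3) k)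
    (hP : ∀ m ∈ P.support, (2 : ℤ) ≤ wt (fun _ : Fin 3 => (1 : ℤ)) m) :
    ∀ m ∈ (aeval φ P).support, (2 : ℤ) ≤ wt (fun _ : Fin 3 => (1 : ℤ)) m := by
  classical
  have hone : ∀ i : Fin 3, (1 : ℤ) ≤ (fun _ : Fin 3 => (1 : ℤ)) i := fun _ => le_rfl
  rw [P.as_sum, map_sum]
  refine wtGe_sum _ _ fun d hd => ?_
  rw [aeval_monomial, Finsupp.prod_pow, MvPolynomial.algebraMap_eq]
  refine wtGe_C_mul _ ?_
  have hprod := wtGe_prod (Finset.univ : Finset (Fin 3)) (fun a => φ a ^ d a) (fun a => (d a : ℤ) * 1)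
    fun a _ => wtGe_pow (one_le_wt_of_constantCoeff_eq_zero hone (h0 a)) (d a)
  have hsum : ∑ a : Fin 3, (d a : ℤ) * 1 = wt (fun _ : Fin 3 => (1 : ℤ)) d := by simp [wt]
  rw [hsum] at hprod
  exact wtGe_mono (hP d hd) hprod

/-- **Linear parts compose**: for `P` without constant term, the `tᵢ`-coefficient of `P(φ₀, φ₁, φ₂)` is `Σⱼ (∂φⱼ/∂tᵢ)(0) · (∂P/∂xⱼ)(0)`.
[OURS · bookkeeping] -/
theorem coeff_single_aeval (φ : Fin 3 → MvPolynomial (Fin 3) k) (h0 : ∀ j, constantCoeff (φ j) = 0) (P : MvPolynomial (Fin 3) k)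
    (hP : constantCoeff P = 0) (i : Fin 3) :
    coeff (Finsupp.single i 1) (aeval φ P) = ∑ j : Fin 3, coeff (Finsupp.single i 1) (φ j) * coeff (Finsupp.single j 1) P := by
  classical
  -- split `P` into its linear part and a part of degree `≥ 2`
  set ℓ : MvPolynomial (Fin 3) k := ∑ j : Fin 3, monomial (Finsupp.single j 1) (coeff (Finsupp.single j 1) P) with hℓ
  set P₂ := P - ℓ with hP₂
  have hcoeffℓ : ∀ m, coeff m ℓ = ∑ j : Fin 3, if Finsupp.single j 1 = m then coeff (Finsupp.single j 1) P else 0 := by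
    intro m; simp only [hℓ, coeff_sum, coeff_monomial]
  have hP₂wt : ∀ m ∈ P₂.support, (2 : ℤ) ≤ wt (fun _ : Fin 3 => (1 : ℤ)) m := by
    rw [wtGe_iff_coeff_eq_zero]
    intro m hm
    obtain ⟨p, q, r, rfl⟩ : ∃ p q r, m = eG3 p q r := ⟨m 0, m 1, m 2, (eG3_eta m).symm⟩
    rw [wt_w111_eG3] at hm
    have hcases : (p = 0 ∧ q = 0 ∧ r = 0) ∨ (p = 1 ∧ q = 0 ∧ r = 0) ∨ (p = 0 ∧ q = 1 ∧ r = 0) ∨ (p = 0 ∧ q = 0 ∧ r = 1) := by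
      omega
    have hP0 : coeff (eG3 0 0 0) P = 0 := by rw [coeff_eG3_zero_eq_constantCoeff]; exact hP
    rcases hcases with ⟨rfl, rfl, rfl⟩ | ⟨rfl, rfl, rfl⟩ | ⟨rfl, rfl, rfl⟩ | ⟨rfl, rfl, rfl⟩ <;>
      simp [hP₂, hcoeffℓ, Fin.sum_univ_three, single_zero_eq_eG3, single_one_eq_eG3, single_two_eq_eG3, eG3_eq_iff, hP0]
  have hPeq : P = ℓ + P₂ := by rw [hP₂]; ring
  have h2 := two_le_wt_aeval φ h0 P₂ hP₂wt
  rw [wtGe_iff_coeff_eq_zero] at h2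
  have hz : coeff (Finsupp.single i 1) (aeval φ P₂) = 0 := by
    refine h2 _ ?_
    simp [wt, Finsupp.single_apply]
  conv_lhs => rw [hPeq, map_add, coeff_add, hz, add_zero, hℓ, map_sum, coeff_sum]
  refine Finset.sum_congr rfl fun j _ => ?_
  rw [← C_mul_X_eq_monomial, map_mul, aeval_C, aeval_X, MvPolynomial.algebraMap_eq, coeff_C_mul, mul_comm]

/-- **The Jacobian at `0` of an origin-fixing automorphism is invertible** (`J(θ)·J(θ⁻¹) = 1` by `coeff_single_aeval`). [OURS · bookkeeping] -/
theorem det_jacobian_ne_zero_of_fixesOrigin (θ : MvPolynomial (Fin 3) k ≃ₐ[k] MvPolynomial (Fin 3) k) (hθ : FixesOrigin θ) :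
    (Matrix.of fun i j => coeff (Finsupp.single i 1) (θ (X j))).det ≠ 0 := by
  classical
  set M : Matrix (Fin 3) (Fin 3) k := Matrix.of fun i j => coeff (Finsupp.single i 1) (θ (X j)) with hM
  set M' : Matrix (Fin 3) (Fin 3) k := Matrix.of fun i j => coeff (Finsupp.single i 1) (θ.symm (X j)) with hM'
  have hθaeval : ∀ P, θ P = aeval (fun j => θ (X j)) P := fun P => by
    have h1 : (θ : MvPolynomial (Fin 3) k →ₐ[k] MvPolynomial (Fin 3) k) = aeval (fun j => θ (X j)) :=
      MvPolynomial.algHom_ext fun j => by rw [aeval_X, AlgEquiv.coe_toAlgHom]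
    have := DFunLike.congr_fun h1 P
    rwa [AlgEquiv.coe_toAlgHom] at this
  have hMM' : M * M' = 1 := by
    ext i l
    rw [Matrix.mul_apply]
    have h := coeff_single_aeval (fun j => θ (X j)) hθ (θ.symm (X l)) (fixesOrigin_symm θ hθ l) i
    rw [← hθaeval, AlgEquiv.apply_symm_apply, coeff_X] at h
    simp only [hM, hM', Matrix.of_apply, Matrix.one_apply]
    rw [← h]
    by_cases hil : i = l
    · subst hil; simp
    · rw [if_neg hil, if_neg]
      exact fun h' => hil (Finsupp.single_left_injective one_ne_zero h').symm
  intro hdet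
  have := congrArg Matrix.det hMM'
  rw [Matrix.det_mul, hdet, zero_mul, Matrix.det_one] at this
  exact zero_ne_one this

end S10AllFrames

/-- **(T2) `S10` IS NON-ND IN EVERY POLYNOMIAL FRAME** — for `k` algebraically closed (any characteristic) and EVERY origin-fixing `k`-algebra
automorphism `θ` of `k[t₀,t₁,t₂]` (the frames `IsoHypND`/`IsoHypNDWon` quantify over), `θ(S10)` is NOT locally Newton-nondegenerate.
[OURS · L1 W4.5b · D3-6 (b′): res-L1-w45b-lead-1's RESIDUE-CUSTOMER-S10 §3 Lemma / claim (H1) at the germ level, in the kernel] -/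
theorem not_isLocallyNewtonNondegenerate_specimenS10_allFrames [IsAlgClosed k]
    (θ : MvPolynomial (Fin 3) k ≃ₐ[k] MvPolynomial (Fin 3) k) (hθ : FixesOrigin θ) :
    ¬ IsLocallyNewtonNondegenerate (θ (specimenS10 k)) := by
  have h1 : (θ : MvPolynomial (Fin 3) k →ₐ[k] MvPolynomial (Fin 3) k) = aeval (fun j => θ (X j)) :=
    MvPolynomial.algHom_ext fun j => by rw [aeval_X, AlgEquiv.coe_toAlgHom]
  have h2 := DFunLike.congr_fun h1 (specimenS10 k)
  rw [AlgEquiv.coe_toAlgHom] at h2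
  rw [h2]
  exact not_isLocallyNewtonNondegenerate_aeval_specimenS10 _ hθ (S10AllFrames.det_jacobian_ne_zero_of_fixesOrigin θ hθ)

/-- **(T2′) `¬ LocalND (θ S10)` for every origin-fixing polynomial frame `θ`** — at `θ = 1` this is ✓ `not_localND_specimenS10`. [OURS · L1 W4.5b · D3-6 (b′)] -/
theorem not_localND_specimenS10_allFrames [IsAlgClosed k] (θ : MvPolynomial (Fin 3) k ≃ₐ[k] MvPolynomial (Fin 3) k) (hθ : FixesOrigin θ) :
    ¬ LocalND (θ (specimenS10 k)) :=
  fun h => not_isLocallyNewtonNondegenerate_specimenS10_allFrames θ hθ h.2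

/-- **(T2″) `¬ LocalNDWon (θ S10)` for every origin-fixing polynomial frame `θ`.** [OURS · L1 W4.5b · D3-6 (b′)] -/
theorem not_localNDWon_specimenS10_allFrames [IsAlgClosed k] (θ : MvPolynomial (Fin 3) k ≃ₐ[k] MvPolynomial (Fin 3) k) (hθ : FixesOrigin θ) :
    ¬ LocalNDWon (θ (specimenS10 k)) :=
  fun h => not_localND_specimenS10_allFrames θ hθ h.1

end Summit.ResolutionOfSingularities.ResolutionOfSingularities.Cruxes.EquisingularLiftNat.Sections

end
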